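import Summits.BirchSwinnertonDyer.Rank1Residual.X11b.InterpolationCharacterSupply
import Summits.BirchSwinnertonDyer.Rank1Residual.X11b.Three.LambdaSupplyTwistFamily
import Summits.BirchSwinnertonDyer.BirchSwinnertonDyer.Theorems.BiquadraticEisensteinDescentEisensteinHeartFlatCMInertBadKPrimeAvatarRigidity
import HarnessLib

set_option linter.dupNamespace false
set_option autoImplicit false

/-!
# Crux `EisensteinHeartFlatCMInertBadKPrime` (stmt-BirchSwinnertonDyer-21341), line `hsieh_lambda` — stub R3
# `stub_rangeInfinite`: a point of Hsieh's range is never torsion, so the range is INFINITE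

Lead seat `bsd-wall-cm-bed-p1` g11 (`--supports stmt-BirchSwinnertonDyer-21341`; theorems only; nothing is closed; BSD is not proved).

With R1/R2 (`…RangeCharacter`, `…RangeAvatar`, landed p719262/p719120) Hsieh's range
`R = {(χ, r) : χ everywhere unramified of type (n, −n), n ≥ 1, r a p-adic avatar of χ through the anticyclotomic κ}`
is non-empty for every crux datum. The divisibility `∃ m, p^m·Ch(N) ⊆ (G)` for EVERY `G` pinned only on `R` is false when the set
of evaluation points `{r(γ) − 1}` is FINITE (add `H·∏(T − x_i)` to `G`), so every proof of the crux also uses that `R` is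
INFINITE. This file proves the kernel statement behind it, the registered stub `stub_rangeInfinite` of skeleton v8: for
`(χ, n, r) ∈ R` and `γ` a topological generator of `κ`, **`r(γ)^q ≠ 1` for every `q ≥ 1`** — hence the points
`(χ^q, r^q) ∈ R` (`LambdaSupply.isPAdicAvatarOf_pow`) have pairwise distinct nodes `r(γ)^q − 1`.

Proof: write `r = e ∘ ψ`; if `ψ(γ)^q = 1` then `e ∘ ψ^q` factors through `κ` and is trivial at the unit-level element `γ`
(`κ γ = 1`), hence trivial (`…AvatarRigidity.apply_eq_one_of_factorsThroughZp_of_isUnit`: closed subgroups of `ℤ_p` containing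
a unit are everything); so `ψ^q = 1` and `χ^q`, whose avatar is `e ∘ ψ^q` (`isPAdicAvatarOf_pow`), shares the trivial avatar with
the trivial character, whence `χ^q = 1` (`LambdaSupply.eq_of_isPAdicAvatarOf_of_isPAdicAvatarOf`: Frobenius values at almost all
places determine a Hecke character); but `χ^q` has infinity type `(qn, −qn)` with `qn ≠ 0`, which the trivial character has not
on a totally complex field (`LambdaSupply.not_hasInfinityType_one_of_ne_zero`). No hypothesis on `p` or on the class number.

References: [Weil1956] §1–§2; [Washington1997] §13.1; [CasselsFrohlichANT1967] Ch. VII (Tate) Prop. 4.1; [Hsieh2014Crelle] Prop. 4.9.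
-/

noncomputable section

open scoped NumberField
open NumberField IsDedekindDomain Field Filter Topology
  Literature.NumberTheory.GaloisRepresentations Literature.NumberTheory.EllipticCurves
  Summit.BirchSwinnertonDyer.Rank1Residual.X11b.Three.LambdaSupply
  Summit.BirchSwinnertonDyer.BirchSwinnertonDyer.Theorems.BiquadraticEisensteinDescentEisensteinHeartFlatCMInertBadKPrimeAvatarRigidity

namespace Summit.BirchSwinnertonDyer.BirchSwinnertonDyer.Theorems.BiquadraticEisensteinDescentEisensteinHeartFlatCMInertBadKPrimeRangeInfinite

/-- **A point of Hsieh's range is not torsion** (core form, named hypotheses): for `K` totally complex, `κ` a `ℤ_p`-extension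
with topological generator `γ`, `χ` an everywhere-unramified Hecke character of infinity type `(n, −n)`, `n ≠ 0`, and `r` a `p`-adic
avatar of `χ` factoring through `κ`, one has `r(γ)^q ≠ 1` for every `q ≥ 1`. See the module docstring for the proof.
[cite: Weil1956, §1–§2] [cite: Washington1997, §13.1] [cite: CasselsFrohlichANT1967, Ch. VII Prop. 4.1] -/
theorem avatarValueAt_pow_ne_one {K : Type} [Field K] [NumberField K] [IsTotallyComplex K] {p : ℕ} [Fact p.Prime]
    (κ : ZpExtension K p) {γ : absoluteGaloisGroup K} (hγ : κ.IsTopGenerator γ) (ι : PadicAlgCl p ≃+* ℂ)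
    {χ : HeckeCharacter K} {n : ℤ} (hn : n ≠ 0) {r : FramedGaloisRep K (PadicAlgCl p) 1}
    (hχu : ∀ v : HeightOneSpectrum (𝓞 K), χ.IsUnramifiedAt v)
    (hχt : χ.HasInfinityType (fun _ ↦ n) (fun _ ↦ -n))
    (hav : IsPAdicAvatarOf ι χ r) (hfac : FactorsThroughZp κ r) {q : ℕ} (hq : 0 < q) :
    avatarValueAt r γ ^ q ≠ 1 := by
  intro hu
  -- the currency `r = e ∘ ψ`
  set e := (FramedRep.unitsContinuousMulEquivOfUnique (Fin 1) (PadicAlgCl p) :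
    (PadicAlgCl p)ˣ →ₜ* GL (Fin 1) (PadicAlgCl p)) with he
  set ψ : absoluteGaloisGroup K →ₜ* (PadicAlgCl p)ˣ :=
    ((FramedRep.unitsContinuousMulEquivOfUnique (Fin 1) (PadicAlgCl p)).symm :
      GL (Fin 1) (PadicAlgCl p) →ₜ* (PadicAlgCl p)ˣ).comp r with hψ
  have hr : r = e.comp ψ := by rw [hψ, he, comp_symm_comp_eq]
  rw [hr] at hav hfac hu
  have hχu' : ∀ v : HeightOneSpectrum (𝓞 K), ((p : ℕ) : 𝓞 K) ∉ v.asIdeal → χ.IsUnramifiedAt v := fun v _ => hχu v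
  -- `e ∘ ψ^q` factors through `κ` and is trivial at `γ`
  have hfacq : FactorsThroughZp κ (e.comp (ψ ^ q)) := by
    rw [factorsThroughZp_unitsChar_iff] at hfac ⊢
    intro σ hσ
    rw [ContinuousMonoidHom.pow_apply, hfac σ hσ, one_pow]
  have hγq : (e.comp (ψ ^ q)) γ = 1 := by
    rw [← Summit.BirchSwinnertonDyer.Rank1Residual.X11b.LambdaSupply.avatarValueAt_unitsChar_pow, avatarValueAt_unitsChar] at hu
    have h1 : (((ψ ^ q) γ : (PadicAlgCl p)ˣ) : PadicAlgCl p) = 1 := by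
      apply (algebraMap (PadicAlgCl p) ℂ_[p]).injective
      rw [map_one, ← PadicComplex.coe_eq]
      exact hu
    rw [ContinuousMonoidHom.coe_comp, Function.comp_apply, Units.val_eq_one.mp h1, map_one]
  -- hence trivial everywhere (`κ γ = 1` is a unit of `ℤ_p`)
  have hunit : IsUnit (Multiplicative.toAdd (κ γ)) := by
    rw [show κ γ = Multiplicative.ofAdd 1 from hγ, toAdd_ofAdd]
    exact isUnit_one
  have htriv : ∀ τ, (e.comp (ψ ^ q)) τ = 1 := apply_eq_one_of_factorsThroughZp_of_isUnit κ hfacq hγq hunit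
  have hψq : ψ ^ q = 1 := by
    ext τ
    have h := htriv τ
    rw [ContinuousMonoidHom.coe_comp, Function.comp_apply,
      map_eq_one_iff e (FramedRep.unitsContinuousMulEquivOfUnique (Fin 1) (PadicAlgCl p)).injective] at h
    rw [h]
    rfl
  -- `χ^q` has the trivial avatar, so `χ^q = 1`
  have havq : IsPAdicAvatarOf ι (χ ^ q) (e.comp (ψ ^ q)) := isPAdicAvatarOf_pow ι hav hχu' q
  rw [hψq] at havq
  have heq : χ ^ q = 1 :=
    eq_of_isPAdicAvatarOf_of_isPAdicAvatarOf ι havq (isPAdicAvatarOf_one ι)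
      (fun v _ => isUnramifiedAt_pow' (hχu v) q) (fun v _ => isUnramifiedAt_one' v)
  -- but `χ^q` has infinity type `(qn, -qn)`, `qn ≠ 0`
  have ht := Summit.BirchSwinnertonDyer.Rank1Residual.X11b.LambdaSupply.HasInfinityType.pow_nat hχt q
  rw [heq] at ht
  have hqn : (q : ℤ) * n ≠ 0 := mul_ne_zero (by exact_mod_cast hq.ne') hn
  refine Summit.BirchSwinnertonDyer.Rank1Residual.X11b.LambdaSupply.not_hasInfinityType_one_of_ne_zero (K := K) hqn ?_
  have e2 : (fun _ : InfinitePlace K ↦ (q : ℤ) * -n) = fun _ ↦ -((q : ℤ) * n) := by funext w; ring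
  rw [e2] at ht
  exact ht

/-- **STUB `stub_rangeInfinite` of skeleton v8 of crux `EisensteinHeartFlatCMInertBadKPrime` (line `hsieh_lambda`)**, proved: the
registered signature verbatim — for `K` imaginary quadratic, `κ` a `ℤ_p`-extension with topological generator `γ`, `ι′`, and a point
`(χ, n, r)` of Hsieh's range (`χ` everywhere unramified of type `(n, −n)`, `n > 0`, `IsPAdicAvatarOf ι′ χ r`, `FactorsThroughZp κ r`):
`avatarValueAt r γ ^ q ≠ 1` for all `q > 0`. `= avatarValueAt_pow_ne_one`.
[cite: Weil1956, §1–§2] [cite: Washington1997, §13.1] [cite: CasselsFrohlichANT1967, Ch. VII Prop. 4.1] -/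
theorem stub_rangeInfinite :
    ∀ (K : Type) [Field K] [NumberField K] (p : ℕ) [Fact p.Prime], IsImaginaryQuadratic K →
      ∀ (κ : ZpExtension K p) (γ : Field.absoluteGaloisGroup K), κ.IsTopGenerator γ →
        ∀ (ι' : PadicAlgCl p ≃+* ℂ) (χ : HeckeCharacter K) (n : ℕ) (r : FramedGaloisRep K (PadicAlgCl p) 1), 0 < n →
          (∀ v : HeightOneSpectrum (𝓞 K), χ.IsUnramifiedAt v) →
          χ.HasInfinityType (fun _ ↦ (n : ℤ)) (fun _ ↦ -(n : ℤ)) →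
          IsPAdicAvatarOf ι' χ r → FactorsThroughZp κ r →
          ∀ q : ℕ, 0 < q → avatarValueAt r γ ^ q ≠ 1 := by
  intro K _ _ p _ hK κ γ hγ ι' χ n r hn hχu hχt hav hfac q hq
  haveI : IsTotallyComplex K := hK.2
  exact avatarValueAt_pow_ne_one κ hγ ι' (by exact_mod_cast hn.ne') hχu hχt hav hfac hq

end Summit.BirchSwinnertonDyer.BirchSwinnertonDyer.Theorems.BiquadraticEisensteinDescentEisensteinHeartFlatCMInertBadKPrimeRangeInfinite

end
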